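import Summits.QuantumFields.BalabanUV.Beta.GAN24.DressedKernelOnCurrent
import Summits.QuantumFields.BalabanUV.Beta.GAN24.PeriodicForceMultiplier

/-!
# `BalabanUV.Beta.GAN24.DressedKernelOnCurrentStep` — binder row G-an2-4 ∕ (CONV-C), W-slot CT-W, conservation law (C)∕(C)sym AT LEVELS `j ≥ 1`, fact (d1) «Φ = 0» of this
# lineage's notes `HOME/b2b-balaban-gan24-formalise-leaf-04/g64/CSYM-D3-ANATOMY.md` §3 ∕ `g67/CSYM-LEVEL0-KERNEL-BLUEPRINT.md` §11 AT EVERY LEVEL: **THE MULTIPLIER ROWS OF THE DRESSED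
# STEP KERNEL `X̃♮_j = unitK s_f s_m (coDressKBmAt ρ Lc (KInvStep Lc j))` KILL EVERY `Lc`-PERIODIC DIVERGENCE-FREE CURRENT WITH ZERO CELL TOTALS** — 8 `DressedKernelOnCurrent`'s
# level-`0` theorem `tsum_dressedStep_zero_inr_mul_current` with `0 ↦ j`

NOT IN PRINT; OUR BOOKKEEPING ([folklore] BY NAME: 8 `DressedKernelOnCurrent.tsum_coDressKBmAt_inr_inl_mul` (`(Πᵀ K Π)_mf·t = K_mf·(Πᵀ_bm t)`, any kernel) + leaf-02's
`CoProjBmDivFree.coProjBmAt_eq_self_of_divFree` (`Πᵀ_bm t = t` on divergence-free forms) + g64's `PeriodicForceMultiplier.tsum_KInvStep_inr_inl_mul_periodic_eq_zero` (the multiplier row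
of `KInvStep Lc j` against a block-periodic force reads only its cell total — EVERY `j`) + an2's `OneStepKernelFamily.KInvStep_inr_off` (multiplier legs of `KInvStep Lc j` live on the
coarse points); G-an2-4 formalisation swarm, leaf prover `b2b-balaban-gan24-formalise-leaf-04`, gen 68).  HONEST FRAMING (cell contract, verbatim): «discharging `BetaPertH` makes
Bałaban's UV stability UNCONDITIONAL — a real constructive-QFT result; it is NOT the continuum limit and NOT the Clay problem.»  HONEST DEPENDENCY (verbatim): «continuum YM on T⁴ ⇐
BetaPertH ∧ nine spine estimates (0/9 proved); BetaPertH ⇐ (D1) ∧ (D4) ∧ CAP+tail; G-an2-4 gates asym, D1 and NE2/3/4.»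

WHY.  The level-`j` sector ledger of the dressed source's ff zero mode (`DressedSourceZeroModeWords.zmode_dressedSource_inl_inl`, every `j`) has the `VH_c ⊗ E_{u′}` word killed at
level `0` (24 `VHWordsZeroLattice`) by exactly this fact about `X̃♮_0`: the bond-resummed exit-face current of the Wilson slot is `Lc`-periodic, divergence-free, with zero cell totals,
and the multiplier rows of the dressed kernel kill such currents.  At level `j ≥ 1` the current changes (the value-function cubic table `e3OfK` replaces `wilsonA`; leaf-06 g52
`ExitFaceHalfVertexSplit`), the kernel fact does not: this file states it for every `j` so that 24_j reduces to the three properties of the level-`j` current (ENGINE, this lineage's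
g64 kit `words2` at `jb = 1`, D = 2, n = 3, twin `HOME/…/leaf-04/g64/outputs/words2_n3_jb1.json`: the level-1 half-vertex current is `Lc`-periodic (1e-15), divergence-free (6e-16),
`Πᵀ_bm`-fixed (6e-16), and `K_mf·Πᵀ_bm t` = 9.7e-19 on scale 1.1e-2 — weight 0, decides nothing here).

WHAT ([folklore]; generic `d`, in-block root `ρ = toSite r`, `1 ≤ Lc`, EVERY level `j`, all units `s_f s_m`; 0 `def`, 0 cited facts, 0 `def … : Prop`, 0 sorry):
`tsum_KInvStep_inr_row_mul_current_eq_zero` (the undressed multiplier row of `KInvStep Lc j` at ANY first leg against a periodic force with zero cell totals: coarse first legs by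
`PeriodicForceMultiplier`, the others are zero rows), **`tsum_dressedStep_inr_mul_current`** (the headline:
`Σ'_z Σ_b X̃♮_j x z (inr m) (inl b)·t b z = 0` for `t β (q + Lc•s) = t β q`, `Σ_β (t β p − t β (p − e_β)) = 0`, `Σ_{r∈box} t l (toSite r) = 0`).  Asserts NO value of Bałaban's
tables; discharges NOTHING of (C)sym ∕ (Q-D) ∕ (Q-D-rate) ∕ «T2Shape» ∕ «T2Drift» ∕ (hW, hWall); NEVER «G-an2-4 closed» as (CONV-C); NOT D1, NOT `BetaPertH`, NOT continuum, NOT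
Clay.  2026-08-23; no existing file touched.
-/

noncomputable section

open Finset
open scoped BigOperators
open Literature.MathematicalPhysics.QuantumFieldTheory
open Literature.MathematicalPhysics.QuantumFieldTheory.Balaban1983to89
open Literature.MathematicalPhysics.QuantumFieldTheory.Balaban1983to89.Beta
open ExpKernelCalculus (Site MKer Decays)
open OneStepResolventKernel (Fib eq_zsmul_quo_of_proj)
open OneStepKernelFamily (KInvStep decays_KInvStep KInvStep_inr_off)
open AffineAveraging (Form1 box toSite unitVec)
open Literature.Probability.LatticeModels (Torus.proj)
open LatticeForm (quo)
open Summit.QuantumFields.BalabanUV.Beta.AxialDressingRooted (coDressKBmAt)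
open Summit.QuantumFields.BalabanUV.Beta.HessKerDressedUnits (unitK unitK_apply legScale_inl legScale_inr)
open Summit.QuantumFields.BalabanUV.Beta.GAN24.CoProjBmDivFree (coProjBmAt_eq_self_of_divFree)
open Summit.QuantumFields.BalabanUV.Beta.GAN24.PeriodicForceMultiplier (bounded_of_periodic summable_row_mul_bounded tsum_KInvStep_inr_inl_mul_periodic_eq_zero)
open Summit.QuantumFields.BalabanUV.Beta.GAN24.DressedKernelOnCurrent (tsum_coDressKBmAt_inr_inl_mul summable_row)

namespace Summit.QuantumFields.BalabanUV.Beta.GAN24.DressedKernelOnCurrentStep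

variable {d : ℕ} {Lc : ℕ} [NeZero Lc] {r : Fin (d + 1) → ℕ}

/-- [folklore] **THE MULTIPLIER ROW OF `KInvStep Lc j` AT ANY FIRST LEG AGAINST A BLOCK-PERIODIC FORCE WITH ZERO CELL TOTALS VANISHES** (every `j`): at a coarse first leg
`x = Lc•q` this is `PeriodicForceMultiplier.tsum_KInvStep_inr_inl_mul_periodic_eq_zero` component by component; off the coarse points the row is zero (`KInvStep_inr_off`). -/
theorem tsum_KInvStep_inr_row_mul_current_eq_zero (j : ℕ) {t : Form1 (d + 1) ℝ} (htp : ∀ l y s, t l (y + (Lc : ℤ) • s) = t l y)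
    (h0 : ∀ l, ∑ r' ∈ box (d + 1) Lc, t l (toSite r') = 0) (x : Site (d + 1)) (m : Fin (d + 1)) :
    ∑' z, ∑ b, KInvStep (d := d) Lc j x z (Sum.inr m) (Sum.inl b) * t b z = 0 := by
  obtain ⟨δ, C, hδ, -, hK⟩ := decays_KInvStep (d := d) (Lc := Lc) j
  have hB : ∀ b z, |t b z| ≤ ∑ l, ∑ r' ∈ box (d + 1) Lc, |t l (toSite r')| := fun b z =>
    (bounded_of_periodic (Lc := Lc) (V := fun y => t b y) (fun y s => htp b y s) z).trans
      (Finset.single_le_sum (f := fun l => ∑ r' ∈ box (d + 1) Lc, |t l (toSite r')|) (fun l _ => Finset.sum_nonneg fun _ _ => abs_nonneg _) (Finset.mem_univ b))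
  have hs : ∀ b, Summable fun z => KInvStep (d := d) Lc j x z (Sum.inr m) (Sum.inl b) * t b z :=
    fun b => summable_row_mul_bounded hK hδ x _ _ (fun z => hB b z)
  rw [Summable.tsum_finsetSum (fun b _ => hs b)]
  by_cases hx : Torus.proj Lc x = 0
  · refine Finset.sum_eq_zero fun b _ => ?_
    rw [eq_zsmul_quo_of_proj (N := Lc) hx]
    exact tsum_KInvStep_inr_inl_mul_periodic_eq_zero (d := d) (Lc := Lc) j m b (quo Lc x) (fun y s => htp b y s) (h0 b)
  · refine Finset.sum_eq_zero fun b _ => ?_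
    simp_rw [KInvStep_inr_off (d := d) (Lc := Lc) j hx m (Sum.inl b)]
    simp

/-- [folklore] **THE MULTIPLIER ROWS OF THE DRESSED STEP KERNEL AT LEVEL `j` KILL A BLOCK-PERIODIC DIVERGENCE-FREE CURRENT WITH ZERO CELL TOTALS** (in-block root, `1 ≤ Lc`, all
units, EVERY `j`): for `t` with `t β (q + Lc•s) = t β q`, `Σ_β (t β p − t β (p − e_β)) = 0` and `Σ_{r ∈ box} t l (toSite r) = 0`,
`Σ'_z Σ_b (unitK s_f s_m (coDressKBmAt ρ Lc (KInvStep Lc j))) x z (inr m) (inl b)·t b z = 0` — `(Πᵀ K Π)_mf·t = K_mf·(Πᵀ_bm t)` (8), `Πᵀ_bm t = t` (leaf-02 `CoProjBmDivFree`),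
and `tsum_KInvStep_inr_row_mul_current_eq_zero`.  8's `tsum_dressedStep_zero_inr_mul_current` is the case `j = 0`. -/
theorem tsum_dressedStep_inr_mul_current (hLc : 1 ≤ Lc) (hr : r ∈ box (d + 1) Lc) (sf sm : ℝ) (j : ℕ) {t : Form1 (d + 1) ℝ}
    (htp : ∀ l y s, t l (y + (Lc : ℤ) • s) = t l y) (hdiv : ∀ p : Site (d + 1), ∑ β : Fin (d + 1), (t β p - t β (p - unitVec β)) = 0)
    (h0 : ∀ l, ∑ r' ∈ box (d + 1) Lc, t l (toSite r') = 0) (x : Site (d + 1)) (m : Fin (d + 1)) :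
    ∑' z, ∑ b, unitK sf sm (coDressKBmAt (toSite r) Lc (KInvStep (d := d) Lc j)) x z (Sum.inr m) (Sum.inl b) * t b z = 0 := by
  obtain ⟨δ, C, hδ, -, hK⟩ := decays_KInvStep (d := d) (Lc := Lc) j
  have hB := fun b z => (bounded_of_periodic (Lc := Lc) (V := fun y => t b y) (fun y s => htp b y s) z).trans
    (Finset.single_le_sum (f := fun l => ∑ r' ∈ box (d + 1) Lc, |t l (toSite r')|) (fun l _ => Finset.sum_nonneg fun _ _ => abs_nonneg _) (Finset.mem_univ b))
  have e1 : ∀ z, ∑ b, unitK sf sm (coDressKBmAt (toSite r) Lc (KInvStep (d := d) Lc j)) x z (Sum.inr m) (Sum.inl b) * t b z =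
      (sm * sf) * ∑ b, coDressKBmAt (toSite r) Lc (KInvStep (d := d) Lc j) x z (Sum.inr m) (Sum.inl b) * t b z := by
    intro z
    rw [Finset.mul_sum]
    exact Finset.sum_congr rfl fun b _ => by rw [unitK_apply, legScale_inr, legScale_inl]; ring
  rw [tsum_congr e1, tsum_mul_left,
    tsum_coDressKBmAt_inr_inl_mul hLc hr (fun x m b => summable_row hK hδ x _ _) hB x m,
    coProjBmAt_eq_self_of_divFree hLc hr hdiv, tsum_KInvStep_inr_row_mul_current_eq_zero j htp h0 x m, mul_zero]

end Summit.QuantumFields.BalabanUV.Beta.GAN24.DressedKernelOnCurrentStep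

end
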